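import Summits.KontsevichZagierPeriods.KontsevichZagierPeriods.Theorems.VietaFibreKernelFormCut
import Summits.KontsevichZagierPeriods.KontsevichZagierPeriods.Theorems.ReducedPeriodRing.Negative.RingForms
import Literature.NumberTheory.Transcendental.KZRulesAssociator
import HarnessLib

/-!
# Crux `KernelForm` (stmt-KontsevichZagierPeriods-10447), line `Sketch`: the ring-language
# dictionary of the cut along the value prime

The line cuts Conjecture 1 in kernel form (`KernelForm := ∀ c, eval c = 0 → c ∈ relations`) along
the value prime of the formal period ring: `kernelForm_iff : KernelForm ↔ WeakKernel ∧ Cancellation`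
(file `…VietaFibreKernelFormCut.lean`), with

* `WeakKernel   := ∀ c, eval c = 0 → ∃ s, eval s ≠ 0 ∧ s * c ∈ relations`,
* `Cancellation := ∀ c s, eval s ≠ 0 → s * c ∈ relations → c ∈ relations`.

This file makes the NAME of the idea ("localise at the value prime") literal in Mathlib's language
over the commutative ring `P := KZ.FormalPeriodRing = KZ.FormalRep ⧸ KZ.relations`
(`KZRulesAssociator.lean`: quotient map `KZ.toFormalPeriod : FormalRep →ₙ+* P`, evaluation
`KZ.evalP : P →+* ℝ`, `evalP ⟦c⟧ = eval c`), with value prime `𝔭 := ker evalP` (prime since `ℝ` is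
a domain) and `M := P ∖ 𝔭 = 𝔭.primeCompl` the multiplicative set of classes of non-zero value:

* `cancellation_iff_mem_nonZeroDivisors` — `Cancellation ↔ M ⊆ P⁰` (classes of non-zero value are
  non-zero-divisors);
* `cancellation_iff_injective_algebraMap_localization` — `Cancellation ↔ (P → P_𝔭 injective)`;
* `weakKernel_iff_maximalIdeal_eq_bot` — `WeakKernel ↔ 𝔭 P_𝔭 = 0` (the local ring `P_𝔭` is a
  field);
* `cancellation_of_isDomain` — a domain has Cancellation;
* `kernelForm_iff_isDomain_and_weakKernel` — `KernelForm ↔ IsDomain P ∧ WeakKernel`;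

and, as corollaries, `KernelForm ↔ ker evalP = ⊥ ↔ IsDomain P ∧ IsField P_𝔭 ↔
(P → P_𝔭 injective) ∧ 𝔭 P_𝔭 = 0`.

All statements are inline over the calculus (no new definitions); the statements about `P_𝔭` carry
the primality of `𝔭` as an instance binder (it holds: `isPrime_ker_evalP`, no global instance is
registered here). Nothing conjecture-grade (WeakKernel, Cancellation, KernelForm) is claimed —
only the equivalences.

References: M. Kontsevich, D. Zagier, *Periods* (2001), §1.2 (Conjecture 1), §4.1 (the algebra of
periods); the commutative algebra is Mathlib's localization API (`IsLocalization.map_eq_zero_iff`,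
`IsLocalization.injective`, `Localization.AtPrime.map_eq_maximalIdeal`).
-/

noncomputable section

open MeasureTheory Set
open Literature.NumberTheory.Transcendental

namespace Summit.KontsevichZagierPeriods.KernelForm.LocaliseAtValuePrime

/-! ### Two bookkeeping facts on the quotient map -/

/-- `⟦s⟧ * ⟦c⟧ = 0` in `P` iff `s * c ∈ relations`. [folklore] -/
theorem toFormalPeriod_mul_toFormalPeriod_eq_zero_iff (s c : KZ.FormalRep) :
    KZ.toFormalPeriod s * KZ.toFormalPeriod c = 0 ↔ s * c ∈ KZ.relations := by
  rw [← map_mul, KZ.toFormalPeriod_eq_zero_iff]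

/-- A class of non-zero value is non-zero in `P` (`evalP ⟦s⟧ = eval s`). [folklore] -/
theorem toFormalPeriod_ne_zero_of_eval_ne_zero {s : KZ.FormalRep} (hs : KZ.eval s ≠ 0) :
    KZ.toFormalPeriod s ≠ 0 := by
  intro h0
  apply hs
  rw [← KZ.evalP_toFormalPeriod, h0, map_zero]

/-! ### Cancellation in ring language -/

/-- **A domain has Cancellation**: if `P = FormalRep ⧸ relations` has no zero-divisors, then every
class of non-zero value (which is non-zero, `evalP ⟦s⟧ = eval s`) cancels:
`⟦s⟧ * ⟦c⟧ = 0 ⇒ ⟦c⟧ = 0`. [folklore] -/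
theorem cancellation_of_isDomain :
    IsDomain KZ.FormalPeriodRing → ∀ c s : KZ.FormalRep, KZ.eval s ≠ 0 → s * c ∈ KZ.relations → c ∈ KZ.relations := by
  intro hD c s hs hsc
  haveI := hD
  have hmul : KZ.toFormalPeriod s * KZ.toFormalPeriod c = 0 :=
    (toFormalPeriod_mul_toFormalPeriod_eq_zero_iff s c).mpr hsc
  exact KZ.toFormalPeriod_eq_zero_iff.mp
    ((mul_eq_zero.mp hmul).resolve_left (toFormalPeriod_ne_zero_of_eval_ne_zero hs))

/-- **`Cancellation ↔` classes of non-zero value are non-zero-divisors of `P`**, i.e.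
`𝔭.primeCompl ⊆ P⁰` for the value prime `𝔭 = ker evalP`: both sides say
`⟦s⟧ * ⟦c⟧ = 0 ⇒ ⟦c⟧ = 0` whenever `evalP ⟦s⟧ = eval s ≠ 0` (`toFormalPeriod` is surjective and
multiplicative, `⟦c⟧ = 0 ↔ c ∈ relations`). [folklore] -/
theorem cancellation_iff_mem_nonZeroDivisors :
    (∀ c s : KZ.FormalRep, KZ.eval s ≠ 0 → s * c ∈ KZ.relations → c ∈ KZ.relations) ↔ ∀ x : KZ.FormalPeriodRing, KZ.evalP x ≠ 0 → x ∈ nonZeroDivisors KZ.FormalPeriodRing := by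
  constructor
  · intro hC x hx
    obtain ⟨s, rfl⟩ := KZ.toFormalPeriod_surjective x
    rw [KZ.evalP_toFormalPeriod] at hx
    refine mem_nonZeroDivisors_iff_left.mpr fun y hy => ?_
    obtain ⟨c, rfl⟩ := KZ.toFormalPeriod_surjective y
    exact KZ.toFormalPeriod_eq_zero_iff.mpr
      (hC c s hx ((toFormalPeriod_mul_toFormalPeriod_eq_zero_iff s c).mp hy))
  · intro hN c s hs hsc
    have hx : KZ.toFormalPeriod s ∈ nonZeroDivisors KZ.FormalPeriodRing :=
      hN _ (by rwa [KZ.evalP_toFormalPeriod])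
    exact KZ.toFormalPeriod_eq_zero_iff.mp
      (mem_nonZeroDivisors_iff_left.mp hx _ ((toFormalPeriod_mul_toFormalPeriod_eq_zero_iff s c).mpr hsc))

/-- Membership in the complement of the value prime is non-vanishing of the value. [folklore] -/
theorem mem_primeCompl_ker_evalP_iff [(RingHom.ker KZ.evalP).IsPrime] {x : KZ.FormalPeriodRing} :
    x ∈ (RingHom.ker KZ.evalP).primeCompl ↔ KZ.evalP x ≠ 0 := by
  rw [Ideal.mem_primeCompl_iff, Ne, RingHom.mem_ker]

/-- **`Cancellation ↔ P → P_𝔭` is injective** (`𝔭 = ker evalP` the value prime): the kernel of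
the localization map consists of the elements killed by some `m ∉ 𝔭`
(`IsLocalization.map_eq_zero_iff`), so injectivity says exactly that `P ∖ 𝔭` consists of
non-zero-divisors (`cancellation_iff_mem_nonZeroDivisors`). [folklore] -/
theorem cancellation_iff_injective_algebraMap_localization [(RingHom.ker KZ.evalP).IsPrime] :
    (∀ c s : KZ.FormalRep, KZ.eval s ≠ 0 → s * c ∈ KZ.relations → c ∈ KZ.relations) ↔ Function.Injective (algebraMap KZ.FormalPeriodRing (Localization.AtPrime (RingHom.ker KZ.evalP))) := by
  rw [cancellation_iff_mem_nonZeroDivisors]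
  constructor
  · intro hN
    exact IsLocalization.injective (M := (RingHom.ker KZ.evalP).primeCompl)
      (Localization.AtPrime (RingHom.ker KZ.evalP))
      (fun m hm => hN m (mem_primeCompl_ker_evalP_iff.mp hm))
  · intro hinj x hx
    refine mem_nonZeroDivisors_iff_left.mpr fun y hy => hinj ?_
    rw [map_zero]
    exact (IsLocalization.map_eq_zero_iff (RingHom.ker KZ.evalP).primeCompl
      (Localization.AtPrime (RingHom.ker KZ.evalP)) y).mpr
      ⟨⟨x, mem_primeCompl_ker_evalP_iff.mpr hx⟩, hy⟩

/-! ### The weak kernel in ring language -/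

/-- **`WeakKernel ↔ 𝔭 P_𝔭 = 0`**, i.e. the maximal ideal of the local ring `P_𝔭` vanishes
(`P_𝔭` is a field): `𝔭 P_𝔭 = maximalIdeal P_𝔭` (`Localization.AtPrime.map_eq_maximalIdeal`), and
`𝔭 P_𝔭 = 0` iff every `p ∈ 𝔭` dies in `P_𝔭`, iff every `p ∈ 𝔭` is killed by some `m ∉ 𝔭`
(`IsLocalization.map_eq_zero_iff`) — which for `p = ⟦c⟧`, `eval c = 0`, `m = ⟦s⟧`, `eval s ≠ 0`
reads `s * c ∈ relations`. [folklore] -/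
theorem weakKernel_iff_maximalIdeal_eq_bot [(RingHom.ker KZ.evalP).IsPrime] :
    (∀ c : KZ.FormalRep, KZ.eval c = 0 → ∃ s : KZ.FormalRep, KZ.eval s ≠ 0 ∧ s * c ∈ KZ.relations) ↔ IsLocalRing.maximalIdeal (Localization.AtPrime (RingHom.ker KZ.evalP)) = ⊥ := by
  rw [← Localization.AtPrime.map_eq_maximalIdeal, Ideal.map_eq_bot_iff_le_ker]
  constructor
  · intro hW x hx
    obtain ⟨c, rfl⟩ := KZ.toFormalPeriod_surjective x
    rw [RingHom.mem_ker, KZ.evalP_toFormalPeriod] at hx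
    obtain ⟨s, hs, hsc⟩ := hW c hx
    rw [RingHom.mem_ker, IsLocalization.map_eq_zero_iff (RingHom.ker KZ.evalP).primeCompl
      (Localization.AtPrime (RingHom.ker KZ.evalP))]
    refine ⟨⟨KZ.toFormalPeriod s, mem_primeCompl_ker_evalP_iff.mpr ?_⟩, ?_⟩
    · rwa [KZ.evalP_toFormalPeriod]
    · exact (toFormalPeriod_mul_toFormalPeriod_eq_zero_iff s c).mpr hsc
  · intro hle c hc
    have hx : KZ.toFormalPeriod c ∈ RingHom.ker KZ.evalP := by
      rw [RingHom.mem_ker, KZ.evalP_toFormalPeriod]; exact hc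
    have h0 := hle hx
    rw [RingHom.mem_ker, IsLocalization.map_eq_zero_iff (RingHom.ker KZ.evalP).primeCompl
      (Localization.AtPrime (RingHom.ker KZ.evalP))] at h0
    obtain ⟨⟨m, hm⟩, hmc⟩ := h0
    obtain ⟨s, rfl⟩ := KZ.toFormalPeriod_surjective m
    refine ⟨s, ?_, (toFormalPeriod_mul_toFormalPeriod_eq_zero_iff s c).mp hmc⟩
    have hs := mem_primeCompl_ker_evalP_iff.mp hm
    rwa [KZ.evalP_toFormalPeriod] at hs

/-! ### The crux in ring language -/

/-- **`KernelForm ↔ IsDomain P ∧ WeakKernel`.** `→`: `KernelForm` is injectivity of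
`evalP : P →+* ℝ` (`kzKernelConjecture_iff_injective_evalP`), so `P` embeds in the domain `ℝ`
(`isDomain_of_kernel`), and the weak kernel is the first half of the cut `kernelForm_iff`. `←`: a
domain has Cancellation (`cancellation_of_isDomain`); compose with the cut. [folklore] -/
theorem kernelForm_iff_isDomain_and_weakKernel :
    Summit.KontsevichZagierPeriods.KontsevichZagierPeriods.Theses.VietaFibre.KernelForm ↔ IsDomain KZ.FormalPeriodRing ∧ (∀ c : KZ.FormalRep, KZ.eval c = 0 → ∃ s : KZ.FormalRep, KZ.eval s ≠ 0 ∧ s * c ∈ KZ.relations) := by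
  constructor
  · intro hK
    exact ⟨Summit.KontsevichZagierPeriods.KontsevichZagierPeriods.ReducedPeriodRingNegative.isDomain_of_kernel
      hK, (kernelForm_iff.mp hK).1⟩
  · rintro ⟨hD, hW⟩
    exact kernelForm_iff.mpr ⟨hW, cancellation_of_isDomain hD⟩

/-! ### Corollaries

The statements about `P_𝔭` keep the primality of `𝔭 = ker evalP` as an instance binder, exactly as
the registered statements above; it is discharged by `isPrime_ker_evalP`
(`haveI := isPrime_ker_evalP`). -/

/-- **The value prime `𝔭 = ker evalP` is a prime ideal of `P`** (`ℝ` is a domain;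
`RingHom.ker_isPrime`): the instance binder of the statements about `P_𝔭` is discharged by
`haveI := isPrime_ker_evalP`. [folklore] -/
theorem isPrime_ker_evalP : (RingHom.ker KZ.evalP).IsPrime := RingHom.ker_isPrime _

/-- **`KernelForm ↔ 𝔭 = 0`**: the crux says the value prime of `P` is the zero ideal
(`⟦c⟧ ∈ ker evalP ↔ eval c = 0`, `⟦c⟧ = 0 ↔ c ∈ relations`). [folklore] -/
theorem kernelForm_iff_ker_evalP_eq_bot :
    Summit.KontsevichZagierPeriods.KontsevichZagierPeriods.Theses.VietaFibre.KernelForm ↔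
      RingHom.ker KZ.evalP = ⊥ := by
  rw [← RingHom.injective_iff_ker_eq_bot]
  exact Summit.KontsevichZagierPeriods.KontsevichZagierPeriods.ReducedPeriodRingNegative.kzKernelConjecture_iff_injective_evalP

/-- **`Cancellation ↔ P ∖ 𝔭 ⊆ P⁰`** (submonoid form of `cancellation_iff_mem_nonZeroDivisors`).
[folklore] -/
theorem cancellation_iff_primeCompl_le_nonZeroDivisors [(RingHom.ker KZ.evalP).IsPrime] :
    (∀ c s : KZ.FormalRep, KZ.eval s ≠ 0 → s * c ∈ KZ.relations → c ∈ KZ.relations) ↔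
      (RingHom.ker KZ.evalP).primeCompl ≤ nonZeroDivisors KZ.FormalPeriodRing := by
  rw [cancellation_iff_mem_nonZeroDivisors]
  exact ⟨fun h m hm => h m (mem_primeCompl_ker_evalP_iff.mp hm),
    fun h x hx => h (mem_primeCompl_ker_evalP_iff.mpr hx)⟩

/-- **`WeakKernel ↔ P_𝔭 is a field`** (a local ring is a field iff its maximal ideal vanishes,
`IsLocalRing.isField_iff_maximalIdeal_eq`). [folklore] -/
theorem weakKernel_iff_isField_localization [(RingHom.ker KZ.evalP).IsPrime] :
    (∀ c : KZ.FormalRep, KZ.eval c = 0 → ∃ s : KZ.FormalRep, KZ.eval s ≠ 0 ∧ s * c ∈ KZ.relations) ↔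
      IsField (Localization.AtPrime (RingHom.ker KZ.evalP)) := by
  rw [IsLocalRing.isField_iff_maximalIdeal_eq, weakKernel_iff_maximalIdeal_eq_bot]

/-- **The idea's name, literally: `KernelForm ↔ IsDomain P ∧ IsField P_𝔭`** — Conjecture 1 in
kernel form holds iff the formal period ring is a domain (Cancellation, geometric half) whose local
ring at the value prime is a field (WeakKernel, transcendence half). [folklore] -/
theorem kernelForm_iff_isDomain_and_isField_localization [(RingHom.ker KZ.evalP).IsPrime] :
    Summit.KontsevichZagierPeriods.KontsevichZagierPeriods.Theses.VietaFibre.KernelForm ↔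
      IsDomain KZ.FormalPeriodRing ∧ IsField (Localization.AtPrime (RingHom.ker KZ.evalP)) := by
  rw [kernelForm_iff_isDomain_and_weakKernel, weakKernel_iff_isField_localization]

/-- **`KernelForm ↔ P → P_𝔭 injective ∧ 𝔭 P_𝔭 = 0`**: the cut `kernelForm_iff` transported
through the dictionary. [folklore] -/
theorem kernelForm_iff_injective_and_maximalIdeal_eq_bot [(RingHom.ker KZ.evalP).IsPrime] :
    Summit.KontsevichZagierPeriods.KontsevichZagierPeriods.Theses.VietaFibre.KernelForm ↔
      Function.Injective (algebraMap KZ.FormalPeriodRing (Localization.AtPrime (RingHom.ker KZ.evalP))) ∧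
      IsLocalRing.maximalIdeal (Localization.AtPrime (RingHom.ker KZ.evalP)) = ⊥ := by
  rw [kernelForm_iff, weakKernel_iff_maximalIdeal_eq_bot,
    cancellation_iff_injective_algebraMap_localization, and_comm]

end Summit.KontsevichZagierPeriods.KernelForm.LocaliseAtValuePrime

end
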